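import Literature.NumberTheory.GaloisRepresentations.HomDualReadoutLocal
import Literature.NumberTheory.GaloisRepresentations.SpectralOrdQ
import Literature.NumberTheory.GaloisRepresentations.BlochKatoSelmerGroup
import Literature.NumberTheory.GaloisRepresentations.GaloisCohomologyInfResProofs
import Literature.NumberTheory.GaloisRepresentations.AbsGaloisGroupProofs
import HarnessLib

/-!
# Unramified classes are read off from unit-valued maps (`F5` of the presentation road, local form)

Topic `NumberTheory/GaloisRepresentations`; namespace `Literature.NumberTheory.GaloisRepresentations.HomDual`.
Theorems (and two plumbing lemmas on `k^nr`); no named fact, no instance, no `sorry`.  Sequel to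
`HomDualValuationSplitting` (generic valuation splitting), `HomDualReadoutNaturality` (`δ₀` vs restriction),
`SpectralOrdQ` (`ord : k̄ˣ → ℚ`).

Let `k` be a nonarchimedean local field of characteristic `0`, `0 → X → P → Z → 0` a presentation of a finite
`n`-torsion Galois module `Z` by a permutation module `P` (basis `e` permuted through a `Γ_k`-set `β`) which is
UNRAMIFIED (`I_k = galUnr k` fixes `β` pointwise), and `h : X → k̄ˣ` equivariant whose class
`δ₀ h ∈ H¹(k, Hom_ℤ(Z, k̄ˣ))` is unramified (dies on `k^nr`).  Then (`exists_unitValued_of_unramified`) there is an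
equivariant `h' : X → k̄ˣ` with the same `δ₀` and `ord (h' x) = 0` for all `x`, i.e. `h'` takes values in the units
of `𝒪_{k̄}`.  Proof: over `k^nr` the class vanishes (`map_res_dualδ₀_eq`), so `ι' ∘ h = q' ∘ i` for an equivariant
`q' : P → \overline{k^nr}ˣ` (`dualδ₀_eq_zero_iff`); its values on the basis are `Γ_{k^nr}`-fixed, hence (pulled back
along `k̄ ≃ \overline{k^nr}`) lie in `k^nr`, where `ord` is integral (`SpectralOrdQ`); the generic valuation splitting
`exists_unitValued_dualδ₀_eq` then corrects `h` by an equivariant monomial homomorphism.  This is the local input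
making the idèle-valued map of the presentation road a genuine idèle (unit components off a finite set).

References: Milne, *Arithmetic Duality Theorems* I §2, I Lemma 4.13 (proof), I §4; Serre, *Local Fields* IV §4.
-/

noncomputable section

namespace Literature.NumberTheory.GaloisRepresentations

open Function ContRepresentation Field

/-! ## §1 Plumbing on `k^nr ⊆ k̄` -/

namespace IsNonarchimedeanLocalField

open IntermediateField Literature.AnabelianGeometry.AbsoluteAnabelian

variable (k : Type) [Field k] [ValuativeRel k] [TopologicalSpace k] [IsNonarchimedeanLocalField k]

omit [TopologicalSpace k] [IsNonarchimedeanLocalField k] in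
/-- **`k^nr / k` is normal** (it is stable under `Γ_k`, `smul_mem_maxUnramified`). [cite: SerreLocalFields1979, IV §4] -/
theorem normal_maxUnramified : Normal k (maxUnramified k) := by
  rw [IntermediateField.normal_iff_forall_map_le']
  intro σ x hx
  obtain ⟨y, hy, rfl⟩ := (IntermediateField.mem_map _).1 hx
  have := smul_mem_maxUnramified ((absoluteGaloisGroup.toAlgEquiv k).symm σ) hy
  rwa [absoluteGaloisGroup.smul_def, MulEquiv.apply_symm_apply] at this

/-- `Γ_{k^nr} → Γ_k` lands in the inertia group `I_k = Gal(k̄/k^nr)`. [cite: SerreLocalFields1979, IV §4 Cor. 2 to Prop. 16] -/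
theorem absGaloisRestrict_mem_galUnr (σ : absoluteGaloisGroup (maxUnramified k)) :
    absGaloisRestrict k (maxUnramified k) σ ∈ galUnr k := by
  haveI := normal_maxUnramified k
  rw [galUnr_eq_absInertia, mem_absInertia_iff_forall_mem_maxUnramified]
  exact (mem_absGaloisFixingSubgroup_iff (maxUnramified k) _).1
    (absGaloisRestrict_mem_absGaloisFixingSubgroup k (maxUnramified k) σ)

/-- `Γ_{k^nr} → Γ_k` maps ONTO the inertia group `I_k = Gal(k̄/k^nr)`. [cite: SerreLocalFields1979, IV §4 Cor. 2 to Prop. 16] -/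
theorem exists_absGaloisRestrict_eq_of_mem_galUnr {τ : absoluteGaloisGroup k} (hτ : τ ∈ galUnr k) :
    ∃ σ : absoluteGaloisGroup (maxUnramified k), absGaloisRestrict k (maxUnramified k) σ = τ := by
  haveI := normal_maxUnramified k
  rw [galUnr_eq_absInertia, mem_absInertia_iff_forall_mem_maxUnramified] at hτ
  exact exists_absGaloisRestrict_eq k (maxUnramified k) τ ((mem_absGaloisFixingSubgroup_iff (maxUnramified k) τ).2 hτ)

/-- **Descent from `\overline{k^nr}` to `k^nr`**: an element of `\overline{k^nr}` fixed by `Γ_{k^nr}`, pulled back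
along `k̄ ≃ \overline{k^nr}`, lies in `k^nr ⊆ k̄` (char. `0`). [cite: SerreLocalFields1979, IV §4 Cor. 2 to Prop. 16] -/
theorem absClosureEquiv_symm_mem_maxUnramified [CharZero k] {y : AlgebraicClosure (maxUnramified k)}
    (hy : ∀ σ : absoluteGaloisGroup (maxUnramified k), σ • y = y) :
    (absClosureEquiv k (maxUnramified k)).symm y ∈ maxUnramified k := by
  refine mem_maxUnramified_of_forall_galUnr k fun τ hτ => ?_
  obtain ⟨σ, rfl⟩ := exists_absGaloisRestrict_eq_of_mem_galUnr k hτ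
  apply (absClosureEmbedding k (maxUnramified k)).toRingHom.injective
  change absClosureEmbedding k (maxUnramified k) _ = absClosureEmbedding k (maxUnramified k) _
  rw [absGaloisRestrict_apply_smul, absClosureEmbedding_absClosureEquiv_symm, hy]

end IsNonarchimedeanLocalField

/-! ## §2 Unramified classes come from unit-valued maps -/

namespace HomDual

open Literature.Algebra.Homology Literature.Algebra.Homology.DiscreteRep HomPermutation DiscreteGaloisModule
  IsNonarchimedeanLocalField Literature.AnabelianGeometry.AbsoluteAnabelian

variable {k : Type} [Field k] [ValuativeRel k] [TopologicalSpace k] [IsNonarchimedeanLocalField k] [CharZero k]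
variable {X VP Z : Type}
  [AddCommGroup X] [TopologicalSpace X] [DiscreteTopology X] [Module.Finite ℤ X]
  [AddCommGroup VP] [TopologicalSpace VP] [DiscreteTopology VP] [Module.Finite ℤ VP]
  [AddCommGroup Z] [TopologicalSpace Z] [DiscreteTopology Z] [Module.Finite ℤ Z]
variable {ρX : DiscreteGaloisModule k X} {ρP : DiscreteGaloisModule k VP} {ρZ : DiscreteGaloisModule k Z}
  {i : ρX.toContRepresentation →ⁱL ρP.toContRepresentation}
  {p : ρP.toContRepresentation →ⁱL ρZ.toContRepresentation}
variable {β : Type} [MulAction (absoluteGaloisGroup k) β] (e : Module.Basis β ℤ VP)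

/-- The values `u` of `k̄ˣ` lying in `k^nr`, an additive subgroup of the carrier (a `ℤ`-submodule).
[cite: SerreLocalFields1979, IV §4] -/
def unrValued (k : Type) [Field k] [ValuativeRel k] [TopologicalSpace k] [IsNonarchimedeanLocalField k] :
    Submodule ℤ (UnitsCarrier k) :=
  AddSubgroup.toIntSubmodule
    { carrier := {u | (unitsVal k u : AlgebraicClosure k) ∈ maxUnramified k}
      add_mem' := fun {u v} hu hv => by
        change ((unitsVal k (u + v) : (AlgebraicClosure k)ˣ) : AlgebraicClosure k) ∈ maxUnramified k
        rw [unitsVal_add, Units.val_mul]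
        exact mul_mem hu hv
      zero_mem' := by
        change ((unitsVal k 0 : (AlgebraicClosure k)ˣ) : AlgebraicClosure k) ∈ maxUnramified k
        rw [show unitsVal k 0 = 1 from rfl, Units.val_one]
        exact one_mem _
      neg_mem' := fun {u} hu => by
        change ((unitsVal k (-u) : (AlgebraicClosure k)ˣ) : AlgebraicClosure k) ∈ maxUnramified k
        rw [show unitsVal k (-u) = (unitsVal k u)⁻¹ from rfl, Units.val_inv_eq_inv_val]
        exact inv_mem hu }

omit [CharZero k] in
/-- Membership in `unrValued`. [cite: SerreLocalFields1979, IV §4] -/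
theorem mem_unrValued_iff (u : UnitsCarrier k) :
    u ∈ unrValued k ↔ (unitsVal k u : AlgebraicClosure k) ∈ maxUnramified k := Iff.rfl

/-- **Unramified classes are read off from unit-valued maps.**  Let `0 → X → P → Z → 0` be short exact over a
nonarchimedean local field `k` of characteristic `0`, `P` with a permuted basis `e` on which the inertia group
`I_k = galUnr k` acts trivially (an unramified permutation module), `Z` killed by `n ≠ 0`, and `h : X → k̄ˣ` equivariant
with `δ₀ h` unramified.  Then some equivariant `h' : X → k̄ˣ` has the same `δ₀` and values of valuation `0`.
[cite: MilneADT2006, I Lemma 4.13 (proof), I §4] [cite: SerreLocalFields1979, IV §4] -/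
theorem exists_unitValued_of_unramified (hS : IsSES (toTopRepHom ρX ρP i) (toTopRepHom ρP ρZ p))
    {n : ℕ} (hn : n ≠ 0) (hZ : ∀ z : Z, n • z = 0) (he : PermutedBasis k ρP e)
    (hstab : ∀ b : β, galUnr k ≤ MulAction.stabilizer (absoluteGaloisGroup k) b)
    (h : (homGaloisModule ρX (units k)).toTopRep.ρ.invariants)
    (hunr : dualδ₀ ρX ρP ρZ (units k) i p hS (baer_unitsCarrier k) h ∈
      (homGaloisModule ρZ (units k)).unramifiedSubgroup 1) :
    ∃ h' : (homGaloisModule ρX (units k)).toTopRep.ρ.invariants,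
      dualδ₀ ρX ρP ρZ (units k) i p hS (baer_unitsCarrier k) h' = dualδ₀ ρX ρP ρZ (units k) i p hS (baer_unitsCarrier k) h ∧
      ∀ x : X, ordQ k ((show X →ₗ[ℤ] UnitsCarrier k from (h'.1 : DiscreteRep.HomCarrier X (UnitsCarrier k))) x) = 0 := by
  classical
  -- notation: `k' = k^nr` as a field, `ι : k̄ → k̄'`, `ι⁻¹`
  haveI : Normal k (maxUnramified k) := normal_maxUnramified k
  -- Step 1: over `k'` the class of the transferred map `ι ∘ h` vanishes
  have h1 : dualδ₀ (ρX.restrictField (maxUnramified k)) (ρP.restrictField (maxUnramified k))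
      (ρZ.restrictField (maxUnramified k)) (units (maxUnramified k))
      (restrictIntertwining ρX ρP i) (restrictIntertwining ρP ρZ p) (isSES_restrict ρX ρP ρZ hS)
      (baer_unitsCarrier (maxUnramified k))
      (transferInvariant ρX (units k) (units (maxUnramified k)) (unitsTransfer k (maxUnramified k)) h) = 0 := by
    rw [← map_res_dualδ₀_eq ρX ρP ρZ (units k) (units (maxUnramified k)) (unitsTransfer k (maxUnramified k)) i p hS
      (baer_unitsCarrier k) (baer_unitsCarrier (maxUnramified k)) h,
      (DiscreteGaloisModule.mem_unramifiedSubgroup_iff _ _ _).1 hunr, map_zero]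
  -- Step 2: an equivariant extension `q'` of `ι ∘ h` to `P` over `k'`
  obtain ⟨q', hq'⟩ := (dualδ₀_eq_zero_iff _ _ _ _ _ _ _ _ _).1 h1
  set Q' : VP →ₗ[ℤ] UnitsCarrier (maxUnramified k) :=
    (show VP →ₗ[ℤ] UnitsCarrier (maxUnramified k) from
      (q'.1 : DiscreteRep.HomCarrier VP (UnitsCarrier (maxUnramified k)))) with hQ'def
  have hQ'h : ∀ x : X, Q' (i x) = unitsTransferAddHom k (maxUnramified k)
      ((show X →ₗ[ℤ] UnitsCarrier k from (h.1 : DiscreteRep.HomCarrier X (UnitsCarrier k))) x) := fun x => by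
    have hx := LinearMap.congr_fun (congrArg (fun F : DiscreteRep.HomCarrier X (UnitsCarrier (maxUnramified k)) =>
      (show X →ₗ[ℤ] UnitsCarrier (maxUnramified k) from F)) hq') x
    rw [coe_transferInvariant] at hx
    exact hx.symm
  -- Step 3: the values of `q'` on the basis are `Γ_{k'}`-fixed (inertia fixes `β`)
  have hfix : ∀ (b : β) (σ : absoluteGaloisGroup (maxUnramified k)),
      units (maxUnramified k) σ (Q' (e b)) = Q' (e b) := fun b σ => by
    have hinv := (mem_invariants_iff (ρP.restrictField (maxUnramified k)) (units (maxUnramified k)) q'.1).1 q'.2 σ (e b)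
    have hb : (ρP.restrictField (maxUnramified k)) σ (e b) = e b := by
      rw [GaloisRep.restrictField_apply, he]
      exact congrArg e (MulAction.mem_stabilizer_iff.1 (hstab b (absGaloisRestrict_mem_galUnr k σ)))
    rw [hb] at hinv
    exact hinv.symm
  -- Step 4: pull the values back to `k̄ˣ`; they lie in `k^nr`
  let a : β → (AlgebraicClosure k)ˣ := fun b =>
    Units.map ((absClosureEquiv k (maxUnramified k)).symm : AlgebraicClosure (maxUnramified k) →* AlgebraicClosure k)
      (unitsVal (maxUnramified k) (Q' (e b)))
  have ha_mem : ∀ b, ((a b : (AlgebraicClosure k)ˣ) : AlgebraicClosure k) ∈ maxUnramified k := fun b => by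
    change (absClosureEquiv k (maxUnramified k)).symm
      ((unitsVal (maxUnramified k) (Q' (e b)) : (AlgebraicClosure (maxUnramified k))ˣ) : AlgebraicClosure _) ∈ _
    refine absClosureEquiv_symm_mem_maxUnramified k fun σ => ?_
    rw [← Units.coe_smul, ← unitsVal_apply, hfix b σ]
  have ha_transfer : ∀ b, unitsTransferAddHom k (maxUnramified k) (UnitsCarrier.ofUnits (a b)) = Q' (e b) := fun b => by
    apply unitsVal_injective (maxUnramified k)
    apply Units.ext
    rw [unitsVal_unitsTransferAddHom, unitsVal_ofUnits, Units.coe_map, MonoidHom.coe_coe]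
    change absClosureEmbedding k (maxUnramified k) ((absClosureEquiv k (maxUnramified k)).symm _) = _
    rw [absClosureEmbedding_absClosureEquiv_symm]
  let q : VP →ₗ[ℤ] UnitsCarrier k := e.constr ℤ fun b => UnitsCarrier.ofUnits (a b)
  have hq_transfer : ∀ y : VP, unitsTransferAddHom k (maxUnramified k) (q y) = Q' y := by
    intro y
    have hlin : (unitsTransferAddHom k (maxUnramified k)).toIntLinearMap ∘ₗ q = Q' := by
      refine e.ext fun b => ?_
      rw [LinearMap.comp_apply, Module.Basis.constr_basis]
      exact ha_transfer b
    exact LinearMap.congr_fun hlin y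
  -- `q` extends `h` along `i` (`ι` is injective)
  have hq : ∀ x : X, q (i x) = (show X →ₗ[ℤ] UnitsCarrier k from (h.1 : DiscreteRep.HomCarrier X (UnitsCarrier k))) x :=
    fun x => by
    apply unitsVal_injective k
    have h2 := hq_transfer (i x)
    rw [hQ'h x] at h2
    have h3 := congrArg (unitsVal (maxUnramified k)) h2
    rw [unitsVal_unitsTransferAddHom, unitsVal_unitsTransferAddHom] at h3
    exact Units.ext ((absClosureEmbedding k (maxUnramified k)).injective (congrArg (fun u : (AlgebraicClosure _)ˣ =>
      (u : AlgebraicClosure (maxUnramified k))) h3))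
  -- the values of `q` lie in `k^nr`, hence have integral valuation
  have hrange : ∀ y : VP, q y ∈ unrValued k := by
    have hle : LinearMap.range q ≤ unrValued k := by
      rw [Module.Basis.constr_range, Submodule.span_le]
      rintro _ ⟨b, rfl⟩
      exact ha_mem b
    exact fun y => hle (LinearMap.mem_range_self q y)
  have hint : ∀ y : VP, ∃ m : ℤ, (m : ℚ) = ordQ k (q y) := fun y => exists_int_cast_eq_ordQ k (hrange y)
  -- Step 5: valuation splitting
  obtain ⟨ϖ, hϖΓ, hϖ⟩ := exists_ordQ_eq_one k
  exact exists_unitValued_dualδ₀_eq (ordQ k) (ordQ_smul k) e hS (baer_unitsCarrier k) hn hZ he ϖ hϖΓ hϖ h q hq hint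

/-- The unit-valued refinement in terms of absolute values: `‖h' x‖ = 1` for all `x`.
[cite: MilneADT2006, I Lemma 4.13 (proof), I §4] -/
theorem exists_algNorm_eq_one_of_unramified (hS : IsSES (toTopRepHom ρX ρP i) (toTopRepHom ρP ρZ p))
    {n : ℕ} (hn : n ≠ 0) (hZ : ∀ z : Z, n • z = 0) (he : PermutedBasis k ρP e)
    (hstab : ∀ b : β, galUnr k ≤ MulAction.stabilizer (absoluteGaloisGroup k) b)
    (h : (homGaloisModule ρX (units k)).toTopRep.ρ.invariants)
    (hunr : dualδ₀ ρX ρP ρZ (units k) i p hS (baer_unitsCarrier k) h ∈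
      (homGaloisModule ρZ (units k)).unramifiedSubgroup 1) :
    ∃ h' : (homGaloisModule ρX (units k)).toTopRep.ρ.invariants,
      dualδ₀ ρX ρP ρZ (units k) i p hS (baer_unitsCarrier k) h' = dualδ₀ ρX ρP ρZ (units k) i p hS (baer_unitsCarrier k) h ∧
      ∀ x : X, algNorm k (unitsVal k
        ((show X →ₗ[ℤ] UnitsCarrier k from (h'.1 : DiscreteRep.HomCarrier X (UnitsCarrier k))) x) : AlgebraicClosure k) = 1 := by
  obtain ⟨h', hδ, hord⟩ := exists_unitValued_of_unramified e hS hn hZ he hstab h hunr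
  exact ⟨h', hδ, fun x => (ordQ_eq_zero_iff k _).1 (hord x)⟩

end HomDual

end Literature.NumberTheory.GaloisRepresentations

end
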